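import Summits.CriticalPhenomena.PercolationContinuityZ3.Theorems.PercNearOneGluingNoHeavyQuantURPMLaw
import Summits.CriticalPhenomena.PercolationContinuityZ3.Theorems.PercNearOneGluingNoHeavyQuantThreeRootGenericOracle
import Summits.CriticalPhenomena.PercolationContinuityZ3.Theorems.PercNearOneGluingNoHeavyQuantUPartNode
import Summits.CriticalPhenomena.PercolationContinuityZ3.Theorems.PercNearOneGluingNoHeavyQuantRootPatternRegating
import HarnessLib

/-!
# QUANT lane R8, T-DEC: TOOLS FOR THE HEAVY-SINGLE SIBLING STEP — the functionals of census-1 g25's re-gated sub-forests `subRegate`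
# (top, gate count, gated mean; the U-RPM components all have opened mean `fmean L / q₁`), law facts of `flaw` under WEAK validity (root gates
# in `[0,1]`), tree-built certificates of forests with gates in `(0,1]`, gating a finite mixture, and BALANCE ⟹ HEAVY (arm-1 gen 53, architect)

builds on p205010 (kernel theorem, internal audit signed; external expert review pending)

Support file (`--supports stmt-CriticalPhenomena-4575`), QUANT lane seat prim-quant-arm-1 (gen 53, architect), rung R8 of
`run/shared/lean/prim/quant/LADDER.md`; memo `run/shared/lean/prim/quant/prim-quant-arm-1-g53/ARCH-G53.md` §1.  Theorems only, standard axioms, no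
sorries.  Bookkeeping for the sequel `…QuantHeavySingleStep` (the width-`k` heavy-single balanced sibling step from the `GateStepN` oracle = step (C)
of the U-RPM chain; (A)+(B) are census-1 g25's ✓ `…QuantURPMIdentity` / `…QuantURPMLift` / `…QuantURPMLaw`).

* `ftop_eq_sum_get`, `fgates_eq_sum_get`, `sumq_eq_sum_get` (list functionals as sums over positions `Fin L.length`; `fmean_eq_sum_get` is census-1's);
  `ftop_map`, `fgates_map`, `fmean_map`;
* **`ftop_subRegate`, `fgates_subRegate`, `fmean_subRegate`** (`= Σ_{i∈E} Mᵢ`, `Σ_{i∈E} (nᵢ+1)`, `Σ_{i∈E} oᵢ·mean ρᵢ`), `ftop_subRegate_le`,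
  `fgates_subRegate_le` (a sub-forest has at most the top / gate count of the whole), **`fmean_subRegate_openE`** (every U-RPM component
  `L|_E^{o^E}`, `E ≠ ∅`, has gated mean EXACTLY `fmean L / q₁` — the common mean `m*` of ARCH-G52 §3.2);
* `flaw_facts_weak` (nonnegative / vanishing / mass `1` / mean `fmean` for root gates in `[0,1]`: the U-RPM openness may reach `1`),
  **`treeBuiltN_flaw_weak`** (a forest with root gates in `(0,1]` and tree-built sub-forests is `TreeBuiltN` at any floor `v ≤ qᵢ·x₁ᵢ` with at most
  `fgates` nontrivial gates — a sure gate costs nothing, `treeBuiltN_gate_le`), `gate_fsum_mix`;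
* `fQ_le_sumq` (union bound), **`fQ_le_of_balance`**: `fmean L ≤ q₁·mean ρ_t` for all `t` ⟹ `fQ L ≤ Σ q_t ≤ q₁` — the balance condition of the
  heavy-single step IMPLIES the heavy-single orientation (arm-1 g52 stated both for width 3).

HONEST STATUS: bookkeeping only; `SiblingStep`, `GateStepN`, `LightResidDECOracle`, `FarTreeRow` OPEN; RATE class log\* / honest sentence of
`run/shared/lean/prim/quant/README.md` unchanged.  [this work]; `subRegate`/`openE`/`share`: prim-quant-census-1 g25; list binder: prim-quant-stmt g39.
Nothing here is cited as a published result.  The gluing rows served [cite: KozmaNitzan2024, Conjecture 3 (p. 15)]; product measure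
[cite: Grimmett1999, §1.3 p. 10].
-/

noncomputable section

open scoped BigOperators

namespace Summit.CriticalPhenomena.PercolationContinuityZ3.Theorems
namespace Quant
namespace LawDec

open Finset URPM

/-! ### Bookkeeping: the functionals of a re-gated sub-forest, weak law facts, gating a finite mixture -/

/-- `ftop` as a sum over positions. [this work] -/
theorem ftop_eq_sum_get : ∀ L : List Sib, ftop L = ∑ i : Fin L.length, (L.get i).M
  | [] => by simp [ftop]
  | s :: L => by
    rw [show ftop (s :: L) = ftop L + s.M from rfl, ftop_eq_sum_get L]
    simp [Fin.sum_univ_succ, add_comm]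

/-- `fgates` as a sum over positions. [this work] -/
theorem fgates_eq_sum_get : ∀ L : List Sib, fgates L = ∑ i : Fin L.length, ((L.get i).n + 1)
  | [] => by simp [fgates]
  | s :: L => by
    rw [show fgates (s :: L) = fgates L + (s.n + 1) from rfl, fgates_eq_sum_get L]
    simp [Fin.sum_univ_succ, add_comm]

/-- `ftop` of a mapped list is a list sum. [this work] -/
theorem ftop_map {α : Type*} (f : α → Sib) : ∀ l : List α, ftop (l.map f) = (l.map fun a => (f a).M).sum
  | [] => rfl
  | a :: l => by simp only [List.map_cons, ftop, List.sum_cons, ftop_map f l]; omega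

/-- `fgates` of a mapped list is a list sum. [this work] -/
theorem fgates_map {α : Type*} (f : α → Sib) : ∀ l : List α, fgates (l.map f) = (l.map fun a => (f a).n + 1).sum
  | [] => rfl
  | a :: l => by simp only [List.map_cons, fgates, List.sum_cons, fgates_map f l]; omega

/-- `fmean` of a mapped list is a list sum. [this work] -/
theorem fmean_map {α : Type*} (f : α → Sib) : ∀ l : List α, fmean (l.map f) = (l.map fun a => (f a).q * (f a).mean).sum
  | [] => rfl
  | a :: l => by simp only [List.map_cons, fmean, List.sum_cons, fmean_map f l]; ring

/-- **top of a re-gated sub-forest**: `ftop (L|_E^o) = Σ_{i∈E} Mᵢ`. [this work] -/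
theorem ftop_subRegate (L : List Sib) (E : Finset (Fin L.length)) (o : Fin L.length → ℝ) :
    ftop (subRegate L E o) = ∑ i ∈ E, (L.get i).M := by
  unfold subRegate
  rw [ftop_map, ← List.sum_toFinset _ (Finset.sort_nodup _ _), Finset.sort_toFinset]
  rfl

/-- **gate count of a re-gated sub-forest**: `fgates (L|_E^o) = Σ_{i∈E} (nᵢ + 1)`. [this work] -/
theorem fgates_subRegate (L : List Sib) (E : Finset (Fin L.length)) (o : Fin L.length → ℝ) :
    fgates (subRegate L E o) = ∑ i ∈ E, ((L.get i).n + 1) := by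
  unfold subRegate
  rw [fgates_map, ← List.sum_toFinset _ (Finset.sort_nodup _ _), Finset.sort_toFinset]
  rfl

/-- **gated mean of a re-gated sub-forest**: `fmean (L|_E^o) = Σ_{i∈E} oᵢ·mean ρᵢ`. [this work] -/
theorem fmean_subRegate (L : List Sib) (E : Finset (Fin L.length)) (o : Fin L.length → ℝ) :
    fmean (subRegate L E o) = ∑ i ∈ E, o i * (L.get i).mean := by
  unfold subRegate
  rw [fmean_map, ← List.sum_toFinset _ (Finset.sort_nodup _ _), Finset.sort_toFinset]
  rfl

/-- `ftop (L|_E^o) ≤ ftop L`. [this work] -/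
theorem ftop_subRegate_le (L : List Sib) (E : Finset (Fin L.length)) (o : Fin L.length → ℝ) : ftop (subRegate L E o) ≤ ftop L := by
  rw [ftop_subRegate, ftop_eq_sum_get]
  exact Finset.sum_le_univ_sum_of_nonneg fun i => Nat.zero_le _

/-- `fgates (L|_E^o) ≤ fgates L`. [this work] -/
theorem fgates_subRegate_le (L : List Sib) (E : Finset (Fin L.length)) (o : Fin L.length → ℝ) : fgates (subRegate L E o) ≤ fgates L := by
  rw [fgates_subRegate, fgates_eq_sum_get]
  exact Finset.sum_le_univ_sum_of_nonneg fun i => Nat.zero_le _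

/-- **the U-RPM components all have opened mean `fmean L / q₁`**: `fmean (L|_E^{o^E}) = fmean L / q₁` for `E ≠ ∅` (`qᵢ, mean ρᵢ > 0`). [this work] -/
theorem fmean_subRegate_openE (L : List Sib) (q₁ : ℝ) (hq : q₁ ≠ 0) (hqpos : ∀ i : Fin L.length, 0 < (L.get i).q)
    (hmpos : ∀ i : Fin L.length, 0 < (L.get i).mean) (E : Finset (Fin L.length)) (hE : E.Nonempty) :
    fmean (subRegate L E (openE L q₁ E)) = fmean L / q₁ := by
  have hpos : ∀ i : Fin L.length, 0 < (L.get i).q * (L.get i).mean := fun i => mul_pos (hqpos i) (hmpos i)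
  obtain ⟨i₀, hi₀⟩ := hE
  have hfm : 0 < fmean L := by
    rw [fmean_eq_sum_get]; exact Finset.sum_pos (fun i _ => hpos i) ⟨i₀, Finset.mem_univ i₀⟩
  have hcpos : ∀ t, 0 < share L t := fun t => div_pos (hpos t) hfm
  have hsE : 0 < asum (share L) E := Finset.sum_pos (fun t _ => hcpos t) ⟨i₀, hi₀⟩
  rw [fmean_subRegate]
  have e : ∀ i ∈ E, openE L q₁ E i * (L.get i).mean = (fmean L / (q₁ * asum (share L) E)) * share L i := by
    intro i _
    unfold openE lrel share
    field_simp
  rw [Finset.sum_congr rfl e, ← Finset.mul_sum]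
  show fmean L / (q₁ * asum (share L) E) * asum (share L) E = fmean L / q₁
  field_simp

/-- **law facts of the forest law under WEAK validity** (`0 ≤ q ≤ 1` — a sure root gate allowed — and `ρ` a probability law on `{0..M}`):
nonnegative, vanishing above `ftop`, mass `1`, mean `fmean`. [this work] -/
theorem flaw_facts_weak (L : List Sib)
    (hL : ∀ s ∈ L, 0 ≤ s.q ∧ s.q ≤ 1 ∧ (∀ h, 0 ≤ s.ρ h) ∧ (∀ h, s.M < h → s.ρ h = 0) ∧ ∑ h ∈ Finset.range (s.M + 1), s.ρ h = 1) :
    (∀ h, 0 ≤ flaw L h) ∧ (∀ h, ftop L < h → flaw L h = 0) ∧ (∑ h ∈ Finset.range (ftop L + 1), flaw L h = 1) ∧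
      ∑ h ∈ Finset.range (ftop L + 1), (h : ℝ) * flaw L h = fmean L := by
  induction L with
  | nil =>
    refine ⟨fun h => ?_, flaw_eq_zero_of_lt [], by simp [flaw, ftop], by simp [flaw, ftop, fmean]⟩
    simp only [flaw]; split_ifs <;> norm_num
  | cons s L ih =>
    obtain ⟨hq0, hq1, ρ0, ρM, ρ1⟩ := hL s List.mem_cons_self
    obtain ⟨f0, _, f1, fmn⟩ := ih (fun t ht => hL t (List.mem_cons_of_mem s ht))
    obtain ⟨g0, _, g1⟩ := gate_laws s.M s.ρ s.q hq0 hq1 ρ0 ρM ρ1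
    refine ⟨fun h => ?_, flaw_eq_zero_of_lt (s :: L), ?_, ?_⟩
    · simp only [flaw]; exact lconv_nonneg _ _ _ _ f0 g0 h
    · simp only [flaw, ftop]; exact sum_lconv _ _ _ _ f1 g1
    · simp only [flaw, ftop, fmean]
      rw [sum_mul_lconv _ _ _ _ f1 g1, fmn, sum_mul_gate]
      rfl

/-- **a forest with root gates in `(0,1]` is tree-built at any floor below every `qᵢ·x₁ᵢ`, with at most `fgates` nontrivial gates**
(a sure root gate `q = 1` costs no gate: `treeBuiltN_gate_le`). [this work] -/
theorem treeBuiltN_flaw_weak {v : ℝ} (hv0 : 0 < v) (hv1 : v < 1) :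
    ∀ K : List Sib, (∀ t ∈ K, 0 < t.q ∧ t.q ≤ 1 ∧ TreeBuiltN t.x₁ t.n t.M t.ρ ∧ v ≤ t.q * t.x₁) →
      ∃ n', n' ≤ fgates K ∧ TreeBuiltN v n' (ftop K) (flaw K)
  | [], _ => ⟨0, le_rfl, TreeBuiltN.nil v hv0 hv1⟩
  | t :: K, hK => by
    obtain ⟨hq0, hq1, hT, hvq⟩ := hK t List.mem_cons_self
    obtain ⟨n'', hn'', hF⟩ := treeBuiltN_flaw_weak hv0 hv1 K (fun u hu => hK u (List.mem_cons_of_mem t hu))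
    have hb : TreeBuiltN (v / t.q) t.n t.M t.ρ := by
      refine TreeBuiltN.mono hT (div_pos hv0 hq0) ?_
      rw [div_le_iff₀ hq0, mul_comm]; exact hvq
    obtain ⟨m, hm, hG⟩ := treeBuiltN_gate_le v t.q t.n t.M t.ρ hq0 hq1 hb
    refine ⟨n'' + m, ?_, ?_⟩
    · show n'' + m ≤ fgates K + (t.n + 1); omega
    · exact TreeBuiltN.conv hF hG

/-- gating a finite mixture with total weight `1` is the mixture of the gated laws. [this work] -/
theorem gate_fsum_mix {ι : Type*} (s : Finset ι) (w : ι → ℝ) (X : ι → ℕ → ℝ) (q : ℝ) (hw : ∑ i ∈ s, w i = 1) (h : ℕ) :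
    gate (fun k => ∑ i ∈ s, w i * X i k) q h = ∑ i ∈ s, w i * gate (X i) q h := by
  simp only [gate_apply]
  have e : ∀ i ∈ s, w i * (q * X i h + (1 - q) * (if h = 0 then (1 : ℝ) else 0))
      = q * (w i * X i h) + ((1 - q) * (if h = 0 then (1 : ℝ) else 0)) * w i := by
    intro i _; ring
  rw [Finset.sum_congr rfl e, Finset.sum_add_distrib, ← Finset.mul_sum, ← Finset.mul_sum, hw, mul_one]

/-! ### Balance implies the heavy-single orientation -/

/-- the union bound `fQ L ≤ Σ q_t`. [this work] -/
theorem fQ_le_sumq (L : List Sib) (hL : ∀ t ∈ L, t.LawOK) : fQ L ≤ (L.map Sib.q).sum := by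
  induction L with
  | nil => simp [fQ]
  | cons t L ih =>
    obtain ⟨hq0, _, _, _, _⟩ := hL t List.mem_cons_self
    have hL' : ∀ u ∈ L, u.LawOK := fun u hu => hL u (List.mem_cons_of_mem t hu)
    obtain ⟨hQ0, _, _⟩ := fQ_facts L hL'
    have ih' := ih hL'
    simp only [fQ, List.map_cons, List.sum_cons]
    nlinarith [mul_nonneg hq0.le hQ0]

/-- `Σ q_t` as a sum over positions. [this work] -/
theorem sumq_eq_sum_get : ∀ L : List Sib, (L.map Sib.q).sum = ∑ i : Fin L.length, (L.get i).q
  | [] => by simp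
  | s :: L => by
    rw [List.map_cons, List.sum_cons, sumq_eq_sum_get L]
    simp [Fin.sum_univ_succ]

/-- **balance implies the heavy-single orientation**: for tree-built siblings, `fmean L ≤ s.q · mean ρ_t` for all `t ∈ L` (`L ≠ []`) gives
`fQ L ≤ Σ_t q_t ≤ s.q` (sum the balance inequalities weighted by `q_t` and divide by `fmean L > 0`; then the union bound). [this work] -/
theorem fQ_le_of_balance {x : ℝ} (s : Sib) (L : List Sib) (hL : ∀ t ∈ L, t.TreeOK x) (hne : L ≠ [])
    (hbal : ∀ t ∈ L, fmean L ≤ s.q * t.mean) : fQ L ≤ s.q := by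
  have hL' : ∀ t ∈ L, t.LawOK := fun t ht => (hL t ht).lawOK
  have hget : ∀ i : Fin L.length, (L.get i).TreeOK x := fun i => hL _ (List.get_mem L i)
  have hpos : ∀ i : Fin L.length, 0 < (L.get i).q * (L.get i).mean :=
    fun i => mul_pos (hget i).1 ((L.get i).mean_pos (hget i))
  have hk : 0 < L.length := List.length_pos_of_ne_nil hne
  have hfm : 0 < fmean L := by
    rw [fmean_eq_sum_get]; exact Finset.sum_pos (fun i _ => hpos i) (Finset.univ_nonempty_iff.2 ⟨⟨0, hk⟩⟩)
  have key : ∀ i : Fin L.length, (L.get i).q * fmean L ≤ s.q * ((L.get i).q * (L.get i).mean) := by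
    intro i
    have h := mul_le_mul_of_nonneg_left (hbal _ (List.get_mem L i)) (hget i).1.le
    calc (L.get i).q * fmean L ≤ (L.get i).q * (s.q * (L.get i).mean) := h
      _ = s.q * ((L.get i).q * (L.get i).mean) := by ring
  have hsum : (∑ i : Fin L.length, (L.get i).q) * fmean L ≤ s.q * fmean L := by
    have h := Finset.sum_le_sum fun i (_ : i ∈ (Finset.univ : Finset (Fin L.length))) => key i
    rw [← Finset.sum_mul, ← Finset.mul_sum, ← fmean_eq_sum_get] at h
    exact h
  have hQ : ∑ i : Fin L.length, (L.get i).q ≤ s.q := le_of_mul_le_mul_right hsum hfm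
  calc fQ L ≤ (L.map Sib.q).sum := fQ_le_sumq L hL'
    _ = ∑ i : Fin L.length, (L.get i).q := sumq_eq_sum_get L
    _ ≤ s.q := hQ

end LawDec
end Quant
end Summit.CriticalPhenomena.PercolationContinuityZ3.Theorems
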